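import Summits.NavierStokesRegularity.NavierStokesRegularity.Theorems.ScenarioCensusCoarseMeter
import HarnessLib

/-!
# LINE «coarse-meter» port, part 2/2: the rows (§D), proofs of the decided cells (§E), nestings and controls (§F); census KEYS `Row_A2cb` / `Row_A2bv` + `_excluded`,
# `Row_A2cl` (+ edge `row_A2cl_of_treeLerayFloor`), `Row_A2cu` / `Row_A2bu` (OPEN)

Re-homed for the scenario census (typer seat ns-census-typer-1 g8; cells of ns-idea-2 LINE g14-1 «coarse-meter», record-only ADDENDUM proposal 01:56:48Z, critic
idea-crit-3 g7 PASS — no price 02:09:02Z, ref PRE-CHECK asked by lead g10 RULING [9] (item 37); this port makes the decided cells TREE-decided): VERBATIM PORT of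
`pub/ideators/ns-idea-2/lines/coarse-meter/line-coarse-meter.lean` sha16 9ac47ab9aa9477ee (558 l., lean check rc 0, 0 sorry), split for the 400-line rule into
`ScenarioCensusCoarseMeter` (§A–§C) → `…CoarseMeterRows` (§D–§F + census KEYS).  Lean text VERBATIM in namespace `…Theorems.ScenarioCensus.CoarseMeter` (the line's
`…Lines.CoarseMeter` re-homed); port edits: `local notation "E3"` → `abbrev E3` (typer lint: no notation in port files), `@[conjecture]` on the OPEN rows `Row_A2cu` /
`Row_A2bu` (typed only).  `TreeLerayFloor` is the line's VERBATIM restatement (as a `Prop`, not re-proved) of the tree theorem `Theorems.stub_liminfFarPastLiouville`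
(`Theorems/ClockStretchingLawClockCeilingLerayFloor.lean`), whose module the farm does not build at port time — `Row_A2cl` stays decided RELATIVE to it
(`row_A2cl_of_treeLerayFloor`), exactly as filed.  Statements untouched.

No census VALUE is moved here (cells become TREE-decided by name; booking is the lead's); NS regularity is NOT proved; (L′) ⟨10661⟩ is untouched; no summit
statement is proved by this file.
-/

-- the summit and its single problem share the name `NavierStokesRegularity` (D-0017 nested layout)
set_option linter.dupNamespace false

noncomputable section

open Set Function Filter Topology Metric MeasureTheory

namespace Summit.NavierStokesRegularity.NavierStokesRegularity.Theorems.ScenarioCensus.CoarseMeter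

open Literature.Analysis Literature.Analysis.FluidPDE
open Summit.NavierStokesRegularity.NavierStokesRegularity.Theorems.SimilarityEnstrophy
  (typeI_ancient_eq_zero_of_rate_lt_one)
open Summit.NavierStokesRegularity.NavierStokesRegularity.Theorems.SymmetryModuliCountSymmetricLiouville
  (vanishes_of_vanishes_before)

/-! ## D. The rows (census A-block cells, (L′)-shape over `IsTypeIAncientMild C u` BY NAME) -/

/-- **Row A2cb (COARSE-GRAINED FLOOR on backward ends; HEAD of the decided part, PROVED).**
A Type-I ancient mild field (KNSS gauge, `ν = 1`, constant `C`) whose heat average at the relative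
parabolic scale `L` — the coarse-grained field `e^{L²(-t)Δ}u(t)`, `0 < L ≤ 1/2`, `8 C₀ L C ≤ 1`,
`C₀ = oseenSliceConst` — is scale-invariantly small, `4 √(-t) ‖e^{L²(-t)Δ}u(t)‖_∞ ≤ 1`, at all
sufficiently early times, vanishes identically.  NO smallness of `u` itself is assumed: below the
scale `L √(-t)` the field may carry the full Type-I amplitude `C/√(-t)`. -/
def Row_A2cb : Prop :=
  ∀ (C : ℝ) (u : ℝ → E3 → E3), IsTypeIAncientMild C u →
    ∀ L : ℝ, 0 < L → L ≤ 1 / 2 → 8 * oseenSliceConst E3 * L * C ≤ 1 →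
      (∃ T < 0, ∀ t ≤ T, ∀ x, 4 * (Real.sqrt (-t) * ‖heatFlow (u t) (L ^ 2 * (-t)) x‖) ≤ 1) →
      ∀ t < 0, ∀ x, u t x = 0

/-- **Row A2bv (BESOV-TYPE FLOOR on backward ends, all scales up to the parabolic one; PROVED,
corollary of A2cb).**  In the heat-kernel description of `Ḃ^{-1}_{∞,∞}`
(`‖f‖ ≍ sup_σ √σ ‖e^{σΔ}f‖_∞`): a Type-I ancient mild field with
`4 (8 C₀ C + 2) · √σ ‖e^{σΔ}u(t)‖_∞ ≤ 1` for all heat times `0 < σ ≤ (-t)/4` and all sufficiently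
early `t` vanishes identically.  (Only the single scale `σ = (-t)/(8 C₀ C + 2)²` is used.) -/
def Row_A2bv : Prop :=
  ∀ (C : ℝ) (u : ℝ → E3 → E3), IsTypeIAncientMild C u →
    (∃ T < 0, ∀ t ≤ T, ∀ σ : ℝ, 0 < σ → σ ≤ -t / 4 → ∀ x,
      4 * (8 * oseenSliceConst E3 * C + 2) * (Real.sqrt σ * ‖heatFlow (u t) σ x‖) ≤ 1) →
      ∀ t < 0, ∀ x, u t x = 0

/-- **The tree's Leray floor, verbatim** (`Theorems.stub_liminfFarPastLiouville`, route
ClockStretchingLaw, file `Theorems/ClockStretchingLawClockCeilingLerayFloor.lean`, landed 2026-08-17;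
census A2-floor): a Type-I ancient mild field with `32 C₀ √(-t)‖u(t)‖_∞ ≤ 1` along some sequence
`t → -∞` vanishes.  Restated here as a `Prop` (NOT re-proved) because that module is absent from the
current farm snapshot (`lean check`: `remote:stale:unbuilt`); `Row_A2cl` is certified RELATIVE to it. -/
def TreeLerayFloor : Prop :=
  ∀ (C : ℝ) (u : ℝ → E3 → E3), IsTypeIAncientMild C u →
    (∀ T < 0, ∃ t < T, ∀ x, 32 * oseenSliceConst E3 * (Real.sqrt (-t) * ‖u t x‖) ≤ 1) →
      ∀ t < 0, ∀ x, u t x = 0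

/-- **Row A2cl (COARSE-GRAINED FLOOR along a sequence of times; REDUCED to the tree's Leray
floor, `row_A2cl_of_treeLerayFloor`).**  A Type-I ancient mild field whose heat average at the
relative scale `L` with `256 C₀² L C² ≤ 1` is scale-invariantly small,
`64 C₀ √(-t) ‖e^{L²(-t)Δ}u(t)‖_∞ ≤ 1`, along SOME sequence of times `t → -∞`, vanishes identically. -/
def Row_A2cl : Prop :=
  ∀ (C : ℝ) (u : ℝ → E3 → E3), IsTypeIAncientMild C u →
    ∀ L : ℝ, 0 < L → L ≤ 1 / 2 → 256 * oseenSliceConst E3 ^ 2 * L * C ^ 2 ≤ 1 →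
      (∀ T < 0, ∃ t ≤ T, ∀ x,
        64 * oseenSliceConst E3 * (Real.sqrt (-t) * ‖heatFlow (u t) (L ^ 2 * (-t)) x‖) ≤ 1) →
      ∀ t < 0, ∀ x, u t x = 0

/-- **Row A2cu (UNIVERSAL relative scale, along a sequence; OPEN, typed — the calibrating boundary
of the meter).**  For some universal `L₀, ε₀ > 0`: a Type-I ancient mild field, of ANY constant `C`,
whose heat average at the relative scale `L₀` is `ε₀`-small in scale-invariant units along some
sequence of times `t → -∞` vanishes identically.  A nonzero Type-I profile with a THIN CORE (width
`≪ √(-t)/C₀C`, amplitude `C/√(-t)`, `C` large) would refute it; none is known. -/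
@[conjecture] def Row_A2cu : Prop :=
  ∃ L₀ ε₀ : ℝ, 0 < L₀ ∧ L₀ ≤ 1 ∧ 0 < ε₀ ∧
    ∀ (C : ℝ) (u : ℝ → E3 → E3), IsTypeIAncientMild C u →
      (∀ T < 0, ∃ t ≤ T, ∀ x, Real.sqrt (-t) * ‖heatFlow (u t) (L₀ ^ 2 * (-t)) x‖ ≤ ε₀) →
      ∀ t < 0, ∀ x, u t x = 0

/-- **Row A2bu (UNIVERSAL Besov-type threshold on backward ends; OPEN, typed).**  For some
universal `γ > 0`: a Type-I ancient mild field, of ANY constant `C`, with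
`√σ ‖e^{σΔ}u(t)‖_∞ ≤ γ` for all `0 < σ ≤ -t` and all sufficiently early `t` vanishes identically —
the ancient, `C`-free analogue of the Cheskidov–Shvydkoy `Ḃ^{-1}_{∞,∞}` blow-up floor
(Lemarié-Rieusset 2016, Thm 11.3, case `p = ∞`).  `Row_A2bv` is its `C`-dependent decided shadow. -/
@[conjecture] def Row_A2bu : Prop :=
  ∃ γ : ℝ, 0 < γ ∧
    ∀ (C : ℝ) (u : ℝ → E3 → E3), IsTypeIAncientMild C u →
      (∃ T < 0, ∀ t ≤ T, ∀ σ : ℝ, 0 < σ → σ ≤ -t → ∀ x,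
        Real.sqrt σ * ‖heatFlow (u t) σ x‖ ≤ γ) →
      ∀ t < 0, ∀ x, u t x = 0

/-! ## E. Proofs of the decided cells -/

/-- `Row_A2cb` holds: the backward-end bootstrap (`coarse_backward_end`, `ε = 1/4`) gives
`√(-τ)‖u(τ)‖_∞ ≤ 1/2` on a backward end, and `eq_zero_of_small_backward_end` ends it. -/
theorem row_A2cb_holds : Row_A2cb := by
  intro C u h L hL0 hL hLC hyp
  obtain ⟨T, hT, hco⟩ := hyp
  have hco' : ∀ t ≤ T, ∀ x, Real.sqrt (-t) * ‖heatFlow (u t) (L ^ 2 * (-t)) x‖ ≤ 1 / 4 := by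
    intro t ht x
    have := hco t ht x
    linarith
  have hend := coarse_backward_end h hL0 hL hLC hT (by norm_num) hco'
  obtain ⟨h1L, -, -⟩ := scale_facts hL0 hL
  exact eq_zero_of_small_backward_end (m := 1 / 2) h (mul_neg_of_pos_of_neg h1L hT) (by norm_num)
    (fun τ hτ x => (hend τ hτ x).trans (by norm_num))

/-- `Row_A2bv` holds: take the single relative scale `L = 1/(8 C₀ C + 2)` in `Row_A2cb`. -/
theorem row_A2bv_holds : Row_A2bv := by
  intro C u h hyp
  obtain ⟨T, hT, hbes⟩ := hyp
  have hC : 0 ≤ C := h.nonneg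
  have hC₀ : 0 < oseenSliceConst E3 := oseenSliceConst_pos
  set D : ℝ := 8 * oseenSliceConst E3 * C + 2 with hD
  have hD2 : 2 ≤ D := by rw [hD]; nlinarith
  have hD0 : 0 < D := by linarith
  set L : ℝ := 1 / D with hLdef
  have hL0 : 0 < L := by positivity
  have hL : L ≤ 1 / 2 := by
    rw [hLdef, div_le_div_iff_of_pos_left one_pos hD0 (by norm_num)]
    exact hD2
  have hLD : L * D = 1 := by rw [hLdef]; field_simp
  have hLC : 8 * oseenSliceConst E3 * L * C ≤ 1 := by
    have : 8 * oseenSliceConst E3 * L * C = L * D - 2 * L := by rw [hD]; ring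
    rw [this, hLD]
    linarith
  refine row_A2cb_holds C u h L hL0 hL hLC ⟨T, hT, fun t ht x => ?_⟩
  have ht0 : t < 0 := lt_of_le_of_lt ht hT
  have hL2 : L ^ 2 ≤ 1 / 4 := by nlinarith
  have hσ0 : 0 < L ^ 2 * (-t) := mul_pos (pow_pos hL0 2) (by linarith)
  have hσ : L ^ 2 * (-t) ≤ -t / 4 := by nlinarith
  have key := hbes t ht (L ^ 2 * (-t)) hσ0 hσ x
  rw [Real.sqrt_mul (sq_nonneg L), Real.sqrt_sq hL0.le] at key
  -- key : 4 * D * (L * √(-t) * ‖…‖) ≤ 1, and L * D = 1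
  calc 4 * (Real.sqrt (-t) * ‖heatFlow (u t) (L ^ 2 * (-t)) x‖)
      = 4 * D * (L * Real.sqrt (-t) * ‖heatFlow (u t) (L ^ 2 * (-t)) x‖) := by
        rw [show 4 * D * (L * Real.sqrt (-t) * ‖heatFlow (u t) (L ^ 2 * (-t)) x‖)
            = 4 * (L * D) * (Real.sqrt (-t) * ‖heatFlow (u t) (L ^ 2 * (-t)) x‖) by ring, hLD]
        ring
    _ ≤ 1 := key

/-- `Row_A2cl` REDUCED to the tree's Leray floor: ONE application of the window estimate with the
crude a-priori bound `√(-τ)‖u‖ ≤ C` on the window (`K = C`), at the relative scale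
`256 C₀² L C² ≤ 1`, turns coarse smallness at `t` into `32 C₀ √(-τ)‖u(τ)‖_∞ ≤ 1` at `τ = (1 - L²)t`;
the times `τ` run to `-∞` with `t`, and the Leray floor ends it. -/
theorem row_A2cl_of_treeLerayFloor : TreeLerayFloor → Row_A2cl := by
  intro floor C u h L hL0 hL hLC hyp
  have hC : 0 ≤ C := h.nonneg
  have hC₀ : 0 < oseenSliceConst E3 := oseenSliceConst_pos
  obtain ⟨h1L, -, -⟩ := scale_facts hL0 hL
  refine floor C u h (fun T'' hT'' => ?_)
  -- a coarse-small time `t ≤ (T'' - 1)/(1 - L²)`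
  obtain ⟨t, htT, hco⟩ := hyp ((T'' - 1) / (1 - L ^ 2)) (div_neg_of_neg_of_pos (by linarith) h1L)
  have ht0 : t < 0 := lt_of_le_of_lt htT (div_neg_of_neg_of_pos (by linarith) h1L)
  set τ : ℝ := (1 - L ^ 2) * t with hτ
  have hτT : τ < T'' := by
    have : (1 - L ^ 2) * t ≤ (1 - L ^ 2) * ((T'' - 1) / (1 - L ^ 2)) :=
      mul_le_mul_of_nonneg_left htT h1L.le
    rw [mul_div_cancel₀ _ h1L.ne'] at this
    linarith
  have hτ0 : τ < 0 := by linarith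
  refine ⟨τ, hτT, fun x => ?_⟩
  -- the crude window bound `√(-τ)‖u σ y‖ ≤ C`
  have hwin : ∀ σ ∈ Ioo t ((1 - L ^ 2) * t), ∀ y,
      Real.sqrt (-((1 - L ^ 2) * t)) * ‖u σ y‖ ≤ C := by
    intro σ hσ y
    have hσ0 : σ < 0 := hσ.2.trans hτ0
    have hsσ : 0 < Real.sqrt (-σ) := Real.sqrt_pos.2 (by linarith)
    calc Real.sqrt (-((1 - L ^ 2) * t)) * ‖u σ y‖
        ≤ Real.sqrt (-σ) * ‖u σ y‖ :=
          mul_le_mul_of_nonneg_right (Real.sqrt_le_sqrt (by linarith [hσ.2])) (norm_nonneg _)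
      _ ≤ Real.sqrt (-σ) * (C / Real.sqrt (-σ)) :=
          mul_le_mul_of_nonneg_left (h.norm_le hσ0 y) hsσ.le
      _ = C := by field_simp
  set ε : ℝ := 1 / (64 * oseenSliceConst E3) with hε
  have hε0 : 0 ≤ ε := by positivity
  have hco' : ∀ x, Real.sqrt (-t) * ‖heatFlow (u t) (L ^ 2 * (-t)) x‖ ≤ ε := by
    intro x
    have := hco x
    rw [hε, le_div_iff₀ (by positivity)]
    linarith
  have step := coarse_step h hL0 hL ht0 hε0 hC hco' hwin x
  -- `4 C₀ L C² ≤ 1/(64 C₀)`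
  have hsmall : 4 * oseenSliceConst E3 * L * C ^ 2 ≤ ε := by
    rw [hε, le_div_iff₀ (by positivity)]
    nlinarith
  calc 32 * oseenSliceConst E3 * (Real.sqrt (-τ) * ‖u τ x‖)
      ≤ 32 * oseenSliceConst E3 * (ε + 4 * oseenSliceConst E3 * L * C ^ 2) :=
        mul_le_mul_of_nonneg_left step (by positivity)
    _ ≤ 32 * oseenSliceConst E3 * (ε + ε) := by gcongr
    _ = 1 := by rw [hε]; field_simp; ring

/-! ## F. Nestings and controls -/

/-- CONTROL: the coarse hypothesis is WEAKER than slice smallness — heat averaging contracts the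
sup norm (`norm_heatFlow_le`), so `4 √(-t)‖u(t)‖_∞ ≤ 1` on a backward end implies the hypothesis
of `Row_A2cb` at every relative scale. -/
theorem coarse_of_slice {u : ℝ → E3 → E3} {t ε σ : ℝ} (ht : t < 0)
    (hs : ∀ x, Real.sqrt (-t) * ‖u t x‖ ≤ ε) :
    ∀ x, Real.sqrt (-t) * ‖heatFlow (u t) σ x‖ ≤ ε := by
  intro x
  have hs0 : 0 < Real.sqrt (-t) := Real.sqrt_pos.2 (by linarith)
  have hb : ∀ z, ‖u t z‖ ≤ ε / Real.sqrt (-t) := fun z => by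
    rw [le_div_iff₀ hs0, mul_comm]; exact hs z
  have := norm_heatFlow_le hb σ x
  rwa [le_div_iff₀ hs0, mul_comm] at this

/-- NESTING (the OPEN cells are ordered): the universal ONE-SCALE cell `Row_A2cu` implies the
universal ALL-SCALES (Besov-type) cell `Row_A2bu`, with `γ = ε₀ L₀` — one scale is the weaker
instrument, all scales the stronger hypothesis (take `σ = L₀²(-t) ≤ -t`, `√σ = L₀ √(-t)`). -/
theorem row_A2bu_of_row_A2cu : Row_A2cu → Row_A2bu := by
  rintro ⟨L₀, ε₀, hL₀, hL₀1, hε₀, H⟩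
  refine ⟨ε₀ * L₀, by positivity, fun C u h hyp => ?_⟩
  obtain ⟨T, hT, hall⟩ := hyp
  refine H C u h (fun T₁ hT₁ => ⟨min T T₁, min_le_right _ _, fun x => ?_⟩)
  have ht : min T T₁ ≤ T := min_le_left _ _
  have ht0 : min T T₁ < 0 := lt_of_le_of_lt ht hT
  have hσ0 : 0 < L₀ ^ 2 * (-min T T₁) := mul_pos (pow_pos hL₀ 2) (by linarith)
  have hσ : L₀ ^ 2 * (-min T T₁) ≤ -min T T₁ := by
    have : L₀ ^ 2 ≤ 1 := by nlinarith
    nlinarith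
  have key := hall (min T T₁) ht _ hσ0 hσ x
  rw [Real.sqrt_mul (sq_nonneg L₀), Real.sqrt_sq hL₀.le] at key
  have key' : L₀ * (Real.sqrt (-min T T₁) *
      ‖heatFlow (u (min T T₁)) (L₀ ^ 2 * (-min T T₁)) x‖) ≤ L₀ * ε₀ := by
    rw [← mul_assoc, mul_comm L₀ ε₀]; exact key
  exact le_of_mul_le_mul_left key' hL₀

end Summit.NavierStokesRegularity.NavierStokesRegularity.Theorems.ScenarioCensus.CoarseMeter

namespace Summit.NavierStokesRegularity.NavierStokesRegularity.Theorems.ScenarioCensus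

/-! ## Census KEYS (ns `…Theorems.ScenarioCensus`): instrument COARSE METER (block A2) — TREE-decided cells A2cb / A2bv; A2cl relative to the tree's Leray floor; OPEN rows A2cu / A2bu -/

/-- **Cell A2cb** (coarse-grained floor on backward ends: `4√(-t)‖e^{L²(-t)Δ}u(t)‖_∞ ≤ 1` at one relative scale `0 < L ≤ 1/2`, `8C₀LC ≤ 1`, all early `t` ⇒ `u ≡ 0`): `:= CoarseMeter.Row_A2cb`. DECIDED. -/
def Row_A2cb : Prop := CoarseMeter.Row_A2cb
/-- A2cb is EXCLUDED (decided in the tree): `CoarseMeter.row_A2cb_holds`. -/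
theorem row_A2cb_excluded : Row_A2cb := CoarseMeter.row_A2cb_holds

/-- **Cell A2bv** (Besov-type floor on backward ends: `4(8C₀C+2)√σ‖e^{σΔ}u(t)‖_∞ ≤ 1`, `0 < σ ≤ (-t)/4`, all early `t` ⇒ `u ≡ 0`): `:= CoarseMeter.Row_A2bv`. DECIDED. -/
def Row_A2bv : Prop := CoarseMeter.Row_A2bv
/-- A2bv is EXCLUDED (decided in the tree): `CoarseMeter.row_A2bv_holds`. -/
theorem row_A2bv_excluded : Row_A2bv := CoarseMeter.row_A2bv_holds

/-- **Row A2cu** (universal relative scale along a sequence) — typed only: `:= CoarseMeter.Row_A2cu`. OPEN (no witness, no proof). -/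
@[conjecture] def Row_A2cu : Prop := CoarseMeter.Row_A2cu

/-- **Row A2bu** (universal Besov-type threshold on backward ends) — typed only: `:= CoarseMeter.Row_A2bu`. OPEN (no witness, no proof). -/
@[conjecture] def Row_A2bu : Prop := CoarseMeter.Row_A2bu

/-- **Cell A2cl** (coarse-grained floor along a sequence of times, `256C₀²LC² ≤ 1`, `64C₀√(-t)‖e^{L²(-t)Δ}u(t)‖_∞ ≤ 1` along some `t → -∞` ⇒ `u ≡ 0`): `:= CoarseMeter.Row_A2cl`.
DECIDED RELATIVE to the tree's Leray floor (`row_A2cl_of_treeLerayFloor` below); untagged because its closer is a tree theorem in a module the farm does not build. -/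
def Row_A2cl : Prop := CoarseMeter.Row_A2cl
/-- A2cl from the tree's Leray floor (`CoarseMeter.TreeLerayFloor` = the statement of `Theorems.stub_liminfFarPastLiouville` VERBATIM): `CoarseMeter.row_A2cl_of_treeLerayFloor`. -/
theorem row_A2cl_of_treeLerayFloor : CoarseMeter.TreeLerayFloor → Row_A2cl := CoarseMeter.row_A2cl_of_treeLerayFloor
/-- Lattice edge at key level: the OPEN one-scale cell A2cu implies the OPEN Besov-type cell A2bu (`CoarseMeter.row_A2bu_of_row_A2cu`). -/
theorem row_A2bu_of_row_A2cu : Row_A2cu → Row_A2bu := CoarseMeter.row_A2bu_of_row_A2cu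

end Summit.NavierStokesRegularity.NavierStokesRegularity.Theorems.ScenarioCensus

end
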